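import Literature.Analysis.FluidPDE.VorticityFormulationHolds
import Literature.Analysis.FluidPDE.GeometricTransportFormula
import HarnessLib

/-!
# Stagnation-point identities, III (R12′ / RATE-AUDIT §6.6.3 (d)): the vorticity carried by a
# PERSISTENT stagnation point of a classical Navier–Stokes solution — "the accumulator's own
# equation"

HONEST FRAMING (cell `ns-blowup`, seat `ns-blowup-lit3` g8 for the RATE-AUDIT writer; human
rulings D-0035 / D-0074). Nothing here is a claim about Navier–Stokes blow-up or regularity.
WHAT THIS IS NOT: not a statement about the marginal tower N1*; it is the pointwise calculus
behind `instab/RATE-AUDIT.md` §6.6.3 (d), companion of `StagnationPointIdentities.lean` (S1)/(S2)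
and `StagnationPointEigenmodeIdentity.lean` (S4):

> (d) (EXACT pointwise dynamics at a PERSISTENT stagnation point — the accumulator's own
> equation.) Let `u` be smooth NS on the window and `x₀(t)` a `C¹` curve with `u(t, x₀(t)) = 0`
> (exists while `Du(x₀)` stays invertible; `ẋ₀ = −Du⁻¹∂ₜu` by the IFT). Then
> `d/dt[ω(t,x₀(t))] = Du(x₀)·ω(x₀) + Dω(x₀)·ẋ₀ + νΔω(x₀) (+ curl f)`. Reading, term by term:
> STRETCHING of what is already there …; DELIVERY BY DISPLACEMENT of the stagnation point through
> the ambient vorticity gradient …; VISCOUS.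

What is typed (all theorems, no definitions, no named facts), for a classical Navier–Stokes
solution `IsClassicalNSSolutionOn S ν f u p` on a time set `S` of unique differentiability (the
tree's Clay-class vocabulary, `ClassicalSolution.lean`) and a curve `x₀ : ℝ → ℝ³` with one-sided
derivative `x₀' t` within `S` — the EXISTENCE of the persistent stagnation point (the IFT clause)
is a hypothesis, as in the audit ("exists while `Du(x₀)` stays invertible"):

* `hasDerivWithinAt_comp_curve` — chain rule along an arbitrary curve for a jointly smooth field,
  `d/dt w(t, x₀ t) = ∂ₜw(t, x₀ t) + Dw(t)(x₀ t)[ẋ₀ t]` (the tree's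
  `MaterialTransport.hasDerivWithinAt_comp_flow` with a label-independent "flow");
* `timeDeriv_add_fderiv_apply_eq_zero_of_stagnation` — persistence differentiated:
  `u(t, x₀ t) = 0` on `S` ⇒ `∂ₜu(t, x₀ t) + Du(t)(x₀ t)[ẋ₀ t] = 0`; with `Du(x₀ t)` invertible,
  `deriv_stagnation_eq_neg_inv` — `ẋ₀ t = −Du(t)(x₀ t)⁻¹ ∂ₜu(t, x₀ t)` (the IFT velocity);
* `convect_vorticity_eq_zero_of_stagnation` — the transport term `(u·∇)ω` vanishes at a stagnation
  point;
* `hasDerivWithinAt_vorticity_stagnation` — **(d)**: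
  `d/dt ω(t, x₀ t) = Du(t)(x₀ t)[ω(t, x₀ t)] + Dω(t)(x₀ t)[ẋ₀ t] + νΔω(t)(x₀ t) + curl f(t)(x₀ t)`
  within `S`, from the tree's vorticity equation (`IsClassicalNSSolutionOn.curl_timeDerivWithin_eq`,
  `IsSmoothSpaceTimeOn.curl_timeDerivWithin_of_uniqueDiffOn`);
* `hasDerivWithinAt_vorticity_stagnation_of_fixed` — the special case of a FIXED stagnation point
  (`ẋ₀ = 0`: no displacement delivery), and `hasDerivWithinAt_vorticity_stagnation_unforced`.
-/

noncomputable section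

open Set Function
open scoped ContDiff Laplacian InnerProductSpace RealInnerProductSpace

namespace Summit.NavierStokesRegularity.FluidComputer.StagnationPointIdentities

open Literature.Analysis.FluidPDE

section Curve

variable {X₀ : Type*} [NormedAddCommGroup X₀] [NormedSpace ℝ X₀]
variable {F : Type*} [NormedAddCommGroup F] [NormedSpace ℝ F]
variable {S : Set ℝ} {w : ℝ → X₀ → F} {x₀ : ℝ → X₀} {x₀' : ℝ → X₀}

/-- **Chain rule along an arbitrary curve** for a jointly smooth field `w` on `S × X₀`
(`S` of unique differentiability): if `t ↦ x₀ t` has one-sided derivative `x₀' t` within `S`, then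
`d/dt w(t, x₀ t) = ∂ₜw(t, x₀ t) + Dw(t)(x₀ t)[x₀' t]` within `S` — the tree's
`MaterialTransport.hasDerivWithinAt_comp_flow` applied to the label-independent trajectory map
`(t, a) ↦ x₀ t` with "velocity field" `(t, x) ↦ x₀' t`. -/
theorem hasDerivWithinAt_comp_curve (hw : IsSmoothSpaceTimeOn S w) (hS : UniqueDiffOn ℝ S)
    (hx₀ : ∀ t ∈ S, HasDerivWithinAt x₀ (x₀' t) S t) {t : ℝ} (ht : t ∈ S) :
    HasDerivWithinAt (fun s => w s (x₀ s))
      (timeDerivWithin S w t (x₀ t) + fderiv ℝ (w t) (x₀ t) (x₀' t)) S t :=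
  MaterialTransport.hasDerivWithinAt_comp_flow (X := fun s (_ : X₀) => x₀ s)
    (v := fun s (_ : X₀) => x₀' s) hw hS (fun s hs _ => hx₀ s hs) ht (x₀ t)

/-- **Persistence, differentiated**: if `w(t, x₀ t) = 0` for all `t ∈ S`, then
`∂ₜw(t, x₀ t) + Dw(t)(x₀ t)[ẋ₀ t] = 0` (the composite is constant on `S`, so its one-sided
derivative within `S` vanishes; uniqueness of derivatives on a set of unique differentiability). -/
theorem timeDeriv_add_fderiv_apply_eq_zero_of_stagnation (hw : IsSmoothSpaceTimeOn S w)
    (hS : UniqueDiffOn ℝ S) (hx₀ : ∀ t ∈ S, HasDerivWithinAt x₀ (x₀' t) S t)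
    (hstag : ∀ t ∈ S, w t (x₀ t) = 0) {t : ℝ} (ht : t ∈ S) :
    timeDerivWithin S w t (x₀ t) + fderiv ℝ (w t) (x₀ t) (x₀' t) = 0 := by
  have h1 := hasDerivWithinAt_comp_curve hw hS hx₀ ht
  have h2 : HasDerivWithinAt (fun s => w s (x₀ s)) 0 S t :=
    (hasDerivWithinAt_const t S (0 : F)).congr (fun s hs => hstag s hs) (hstag t ht)
  exact (hS t ht).eq_deriv _ h1 h2

/-- **The IFT velocity of a persistent non-degenerate stagnation point**: if moreover `Dw(t)(x₀ t)`
is invertible (given as a continuous linear equivalence `L`), then `ẋ₀ t = −L⁻¹ ∂ₜw(t, x₀ t)`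
(RATE-AUDIT §6.6.3 (d): "`ẋ₀ = −Du⁻¹∂ₜu` by the IFT"). -/
theorem deriv_stagnation_eq_neg_inv (hw : IsSmoothSpaceTimeOn S w) (hS : UniqueDiffOn ℝ S)
    (hx₀ : ∀ t ∈ S, HasDerivWithinAt x₀ (x₀' t) S t) (hstag : ∀ t ∈ S, w t (x₀ t) = 0) {t : ℝ}
    (ht : t ∈ S) (L : X₀ ≃L[ℝ] F) (hL : (L : X₀ →L[ℝ] F) = fderiv ℝ (w t) (x₀ t)) :
    x₀' t = -L.symm (timeDerivWithin S w t (x₀ t)) := by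
  have h := timeDeriv_add_fderiv_apply_eq_zero_of_stagnation hw hS hx₀ hstag ht
  rw [← hL, ContinuousLinearEquiv.coe_coe] at h
  have h' : L (x₀' t) = -timeDerivWithin S w t (x₀ t) := eq_neg_of_add_eq_zero_right h
  rw [← L.symm_apply_apply (x₀' t), h', map_neg]

end Curve

section NavierStokes

variable {S : Set ℝ} {ν : ℝ}
  {f u : ℝ → EuclideanSpace ℝ (Fin 3) → EuclideanSpace ℝ (Fin 3)}
  {p : ℝ → EuclideanSpace ℝ (Fin 3) → ℝ}
  {x₀ x₀' : ℝ → EuclideanSpace ℝ (Fin 3)}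

/-- The vorticity of a jointly smooth velocity is jointly smooth (`curl = curlCLM ∘ D`). -/
theorem isSmoothSpaceTimeOn_vorticity' (hu : IsSmoothSpaceTimeOn S u) (hS : UniqueDiffOn ℝ S) :
    IsSmoothSpaceTimeOn S (vorticity u) := by
  have e : vorticity u = fun t x => curlCLM (fderiv ℝ (u t) x) := by
    funext t x; rfl
  rw [e]
  exact (hu.fderiv_slice hS).clm_comp curlCLM

/-- **The transport term drops at a stagnation point**: `(u·∇)ω (x) = Dω(x)[u x] = 0` where
`u x = 0`. -/
theorem convect_vorticity_eq_zero_of_stagnation {v : EuclideanSpace ℝ (Fin 3) → EuclideanSpace ℝ (Fin 3)}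
    {x : EuclideanSpace ℝ (Fin 3)} (hx : v x = 0) : convect v (curl v) x = 0 := by
  rw [convect_apply, hx, map_zero]

/-- **RATE-AUDIT §6.6.3 (d): the vorticity at a persistent stagnation point of a classical
Navier–Stokes solution.** Let `(u, p)` be a classical solution with force `f` on a time set `S` of
unique differentiability, and `x₀` a curve with `u(t, x₀ t) = 0` for `t ∈ S` and one-sided velocity
`ẋ₀ = x₀'` within `S`. Then, within `S`,
`d/dt ω(t, x₀ t) = Du(t)(x₀ t)[ω(t, x₀ t)] + Dω(t)(x₀ t)[ẋ₀ t] + νΔω(t)(x₀ t) + curl f(t)(x₀ t)`,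
`ω = curl u`: STRETCHING by the local velocity gradient + DELIVERY BY DISPLACEMENT through the
ambient vorticity gradient + VISCOUS diffusion + forcing curl; the transport term `(u·∇)ω` of the
vorticity equation is absent because `u(x₀ t) = 0`. Proof: chain rule along the curve, the swap
`∂ₜ curl u = curl ∂ₜu` and the curl of the momentum equation (tree
`IsSmoothSpaceTimeOn.curl_timeDerivWithin_of_uniqueDiffOn`, `IsClassicalNSSolutionOn.curl_timeDerivWithin_eq`). -/
theorem hasDerivWithinAt_vorticity_stagnation (h : IsClassicalNSSolutionOn S ν f u p)
    (hS : UniqueDiffOn ℝ S) (hx₀ : ∀ t ∈ S, HasDerivWithinAt x₀ (x₀' t) S t)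
    (hstag : ∀ t ∈ S, u t (x₀ t) = 0) {t : ℝ} (ht : t ∈ S) :
    HasDerivWithinAt (fun s => curl (u s) (x₀ s))
      (fderiv ℝ (u t) (x₀ t) (curl (u t) (x₀ t)) + fderiv ℝ (curl (u t)) (x₀ t) (x₀' t)
        + ν • (Δ (curl (u t))) (x₀ t) + curl (f t) (x₀ t)) S t := by
  -- chain rule along the curve for the (jointly smooth) vorticity
  have hω : IsSmoothSpaceTimeOn S (vorticity u) := isSmoothSpaceTimeOn_vorticity' h.smooth_velocity hS
  have h1 := hasDerivWithinAt_comp_curve hω hS hx₀ ht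
  -- the vorticity equation at `x₀ t`: `∂ₜω = νΔω − (u·∇)ω + (ω·∇)u + curl f`, with `(u·∇)ω = 0`
  have h2 : timeDerivWithin S (vorticity u) t (x₀ t) =
      ν • (Δ (curl (u t))) (x₀ t) + convect (curl (u t)) (u t) (x₀ t) + curl (f t) (x₀ t) := by
    rw [← h.smooth_velocity.curl_timeDerivWithin_of_uniqueDiffOn hS ht (x₀ t),
      h.curl_timeDerivWithin_eq hS ht (x₀ t), convect_vorticity_eq_zero_of_stagnation (hstag t ht),
      sub_zero]
  have e : (fun s => vorticity u s (x₀ s)) = fun s => curl (u s) (x₀ s) := rfl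
  rw [e] at h1
  refine h1.congr_deriv ?_
  rw [h2, vorticity_apply, convect_apply]
  abel

/-- **(d) for a FIXED stagnation point** (`u(t, x₀) = 0` for all `t ∈ S`: no displacement, hence no
delivery term): `d/dt ω(t, x₀) = Du(t)(x₀)[ω(t, x₀)] + νΔω(t)(x₀) + curl f(t)(x₀)` within `S`. -/
theorem hasDerivWithinAt_vorticity_stagnation_of_fixed (h : IsClassicalNSSolutionOn S ν f u p)
    (hS : UniqueDiffOn ℝ S) {x₀ : EuclideanSpace ℝ (Fin 3)} (hstag : ∀ t ∈ S, u t x₀ = 0) {t : ℝ}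
    (ht : t ∈ S) :
    HasDerivWithinAt (fun s => curl (u s) x₀)
      (fderiv ℝ (u t) x₀ (curl (u t) x₀) + ν • (Δ (curl (u t))) x₀ + curl (f t) x₀) S t := by
  have h1 := hasDerivWithinAt_vorticity_stagnation (x₀ := fun _ => x₀) (x₀' := fun _ => 0) h hS
    (fun s _ => hasDerivWithinAt_const s S x₀) hstag ht
  simpa only [map_zero, add_zero] using h1

/-- **(d), unforced** (`f = 0`): `d/dt ω(t, x₀ t) = Du·ω + Dω·ẋ₀ + νΔω` at the persistent
stagnation point. -/
theorem hasDerivWithinAt_vorticity_stagnation_unforced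
    {u : ℝ → EuclideanSpace ℝ (Fin 3) → EuclideanSpace ℝ (Fin 3)}
    (h : IsClassicalNSSolutionOn S ν 0 u p) (hS : UniqueDiffOn ℝ S)
    (hx₀ : ∀ t ∈ S, HasDerivWithinAt x₀ (x₀' t) S t) (hstag : ∀ t ∈ S, u t (x₀ t) = 0) {t : ℝ}
    (ht : t ∈ S) :
    HasDerivWithinAt (fun s => curl (u s) (x₀ s))
      (fderiv ℝ (u t) (x₀ t) (curl (u t) (x₀ t)) + fderiv ℝ (curl (u t)) (x₀ t) (x₀' t)
        + ν • (Δ (curl (u t))) (x₀ t)) S t := by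
  have h1 := hasDerivWithinAt_vorticity_stagnation h hS hx₀ hstag ht
  have hc : curl ((0 : ℝ → EuclideanSpace ℝ (Fin 3) → EuclideanSpace ℝ (Fin 3)) t) (x₀ t) = 0 := by
    have : ((0 : ℝ → EuclideanSpace ℝ (Fin 3) → EuclideanSpace ℝ (Fin 3)) t) =
        fun _ => (0 : EuclideanSpace ℝ (Fin 3)) := rfl
    rw [this, curl_eq_curlCLM, fderiv_const_apply, map_zero]
  simpa only [hc, add_zero] using h1

/-- **The ODE for the stretched component, read off (d)**: at a FIXED unforced stagnation point,
if the vorticity there stays an eigenvector direction is not assumed — what (d) gives in general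
is the scalar identity for `‖ω(t, x₀)‖²`:
`d/dt ½‖ω(t,x₀)‖² = ⟪ω, Du(t)(x₀) ω⟫ + ν⟪ω, Δω(t)(x₀)⟫` (stretching quadratic form + viscous term),
the pointwise form of the audit's "STRETCHING … VISCOUS" reading. -/
theorem hasDerivWithinAt_half_norm_sq_vorticity_of_fixed
    {u : ℝ → EuclideanSpace ℝ (Fin 3) → EuclideanSpace ℝ (Fin 3)}
    (h : IsClassicalNSSolutionOn S ν 0 u p) (hS : UniqueDiffOn ℝ S)
    {x₀ : EuclideanSpace ℝ (Fin 3)} (hstag : ∀ t ∈ S, u t x₀ = 0) {t : ℝ} (ht : t ∈ S) :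
    HasDerivWithinAt (fun s => ‖curl (u s) x₀‖ ^ 2 / 2)
      (inner ℝ (curl (u t) x₀) (fderiv ℝ (u t) x₀ (curl (u t) x₀))
        + ν * inner ℝ (curl (u t) x₀) ((Δ (curl (u t))) x₀)) S t := by
  have h1 := hasDerivWithinAt_vorticity_stagnation_unforced (x₀ := fun _ => x₀) (x₀' := fun _ => 0)
    h hS (fun s _ => hasDerivWithinAt_const s S x₀) hstag ht
  simp only [map_zero, add_zero] at h1
  have h2 := h1.norm_sq
  have h3 := h2.div_const 2
  refine h3.congr_deriv ?_
  rw [inner_add_right, real_inner_smul_right]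
  ring

end NavierStokes

end Summit.NavierStokesRegularity.FluidComputer.StagnationPointIdentities
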